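import Summits.QuantumFields.BalabanUV.Beta.EriceRemainderEnclosureHistoryAutonomyComparisonAgeCompositionHeatingCriterionFlow

/-!
# EriceRemainderEnclosureHistoryAutonomyComparisonAgeCompositionLevelGaugePrep — (E116c) route (N), first order: PREPARATIONS FOR THE EVERY-RANGE END
# ((E116d) `…AgeCompositionLevelGauge`): the two real inequalities and the per-age cost bounds of the level-gauge row induction.  (i) THE STIELTJES BOUND
# **`stieltjes_sum_le`**: for a non-negative non-decreasing sequence with increments in `[D, M]`, `D·Σ_{l∈[1,L]} x_l ≤ (x_L − x_0)(x_L + x_0 + M)∕2`; (ii) the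
# per-age budget polynomial **`age_budget_poly`**: `(5∕8)AB + (3∕8)(A−B)(A+B+M) ≤ A²` for `B ≤ A`, `0 ≤ M ≤ A∕2`; (iii) level geometry along an admissible flow
# (levels `a_n = 1∕h(n)²` non-decreasing and concave): `Δa_{n+1} ≤ a_p` (`p ≥ 1`), `2Δa_{n+1} ≤ a_p` (`2 ≤ p ≤ n+1`) (`flow_lev_mono`, `flow_incr_le_lev`,
# `flow_two_incr_le_lev`); (iv) THE COST OF ONE AGE AT ONE ROW, per unit of `ε(m+1)`, IS AT MOST ITS BUDGET SHARE OVER THE LEVEL: for the age `1` (no interior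
# window) `L_1h(m+1)³∕2 ≤ L_1h(m+2)·h(m+1)²` (**`flow_age_one_le`**); for an age `k ≥ 2`, with the interior window sum `S` bounded through the level gauge
# (`S ≤ ε1·h(m+1)²·Σ_{l∈[1,k)} a_{m+1+l}`):  `(L_kh(m+k)³∕2)·ε1 + (L_kh(m+k)³∕2 − L_kh(m+1+k)³∕2)·S ≤ L_kh(m+1+k)·h(m+1)²·ε1` (**`flow_age_ge_two_le`**: first
# entry `≤ (5∕8)·share∕a_{m+k}` since `a_{m+1+k} ≤ (25∕16)a_{m+k}`, decay `≤ (3∕4)·share·Δa_{m+k+1}∕a_{m+k}²` by (E116b) `flow_rate_decay_le`, Stieltjes with the one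
# late increment `Δa_{m+k+1}` below and `Δa_{m+2}` above the interior increments, and the polynomial).  README `HOME/b2b-balaban-beta-d4-p2/g97/README.md` §2.

Cell `pub-balaban`, β-function sub-cell, BINDER row D4 «RemainderConst leaves for Bałaban's split» (`HOME/BINDER-OWNERS.md`; owner lineage `b2b-balaban-beta-an4`;
this file by co-owner #2 lineage `b2b-balaban-beta-d4-p2`, generation 97), β-FLOW TEAM duty (1), FREEZE (0) honoured (def-free; imports (E116b)
`…HeatingCriterionFlow`; uses (E116b) `flow_rate_decay_le`, (E58b) `increment_anti`, (E48a) `strictAnti_of_memFlow` BY NAME; nothing restated).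

HONEST FRAMING (page 1, verbatim and binding).  *"Discharging BetaPertH makes Bałaban's UV stability UNCONDITIONAL — a real constructive-QFT result; it is
NOT the continuum limit and NOT the Clay problem."*  THIS FILE DISCHARGES NOTHING OF THE KIND.  Elementary real analysis about ABSTRACT functionals on a box
]0,γ]^ℕ with displayed floors, profiles and signs — hypotheses of a census, not facts; the form, signs, ages and moments of Bałaban's (1.22) limit functional
are NOT PRINTED ([I] p. 298; GAPS G-t4-U2-1∕-2) and NOT asserted.  Row D4 class UNCHANGED (critical-path width 0; instance 0∕1; D4 DISCHARGE NO DATE).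
HONEST DEPENDENCY: continuum YM on T⁴ ⇐ BetaPertH ∧ nine spine estimates (0/9 proved); BetaPertH ⇐ (D1) ∧ (D4) ∧ CAP+tail; G-an2-4 gates asym, D1 and
NE2/3/4.  NOT CLAIMED: anything printed — NOT B12 Thm 2, NOT BetaPertH, NOT continuum, NOT Clay.

WHAT IS PROVED ([folklore]; 0 `def`, 0 sorry).  §1 **`stieltjes_sum_le`**, **`age_budget_poly`**.  §2 `flow_lev_mono`, `flow_incr_le_lev`, `flow_two_incr_le_lev`,
**`flow_age_one_le`**, **`flow_age_ge_two_le`**.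
-/
noncomputable section
open Finset

namespace Summit.QuantumFields.BalabanUV.Beta.EriceRemainderEnclosureHistoryAutonomyComparisonAgeCompositionLevelGaugePrep

open Literature.MathematicalPhysics.QuantumFieldTheory.Balaban1983to89
open Literature.MathematicalPhysics.QuantumFieldTheory.Balaban1983to89.T4BetaStationary
open Literature.MathematicalPhysics.QuantumFieldTheory.Balaban1983to89.T4BetaFlowWellPosed
open Summit.QuantumFields.BalabanUV.Beta.EriceRemainderEnclosureHistoryAutonomyComparisonAgeCompositionHeatingCriterionFlow (flow_rate_decay_le)
open Summit.QuantumFields.BalabanUV.Beta.EriceRemainderEnclosureHistoryAutonomyComparisonAffineProfile (increment_anti)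
open Summit.QuantumFields.BalabanUV.Beta.EriceRemainderEnclosureHistoryAutonomyOrder (strictAnti_of_memFlow)

/-! ## §1 Two real inequalities -/

/-- **THE STIELTJES BOUND.**  `x_0 ≤ x_1 ≤ …` non-negative with increments in `[D, M]` (`D ≥ 0`) on `[1, L]`:  `D·Σ_{l∈[1,L]} x_l ≤ (x_L − x_0)(x_L + x_0 + M)∕2`
— each `D·x_l ≤ (x_l − x_{l−1})·x_l = (x_l² − x_{l−1}²)∕2 + (x_l − x_{l−1})²∕2 ≤ (x_l² − x_{l−1}²)∕2 + M(x_l − x_{l−1})∕2`, telescoped. [folklore] -/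
theorem stieltjes_sum_le {x : ℕ → ℝ} {D M : ℝ} (hD0 : 0 ≤ D) (hx0 : ∀ l, 0 ≤ x l) :
    ∀ L : ℕ, (∀ l, 1 ≤ l → l ≤ L → D ≤ x l - x (l - 1)) → (∀ l, 1 ≤ l → l ≤ L → x l - x (l - 1) ≤ M) →
      D * ∑ l ∈ Ico 1 (L + 1), x l ≤ (x L - x 0) * (x L + x 0 + M) / 2 := by
  intro L
  induction L with
  | zero => intro _ _; simp
  | succ L ih =>
    intro hD hM
    have ih' := ih (fun l h1 h2 => hD l h1 (by omega)) (fun l h1 h2 => hM l h1 (by omega))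
    rw [sum_Ico_succ_top (by omega : 1 ≤ L + 1), mul_add]
    have h1 : D ≤ x (L + 1) - x L := by have := hD (L + 1) (by omega) le_rfl; simpa using this
    have h2 : x (L + 1) - x L ≤ M := by have := hM (L + 1) (by omega) le_rfl; simpa using this
    have h3 := hx0 (L + 1)
    have h4 : D * x (L + 1) ≤ (x (L + 1) - x L) * x (L + 1) := mul_le_mul_of_nonneg_right h1 h3
    have h5 : (x (L + 1) - x L) * (x (L + 1) - x L) ≤ M * (x (L + 1) - x L) :=
      mul_le_mul_of_nonneg_right h2 (by linarith)
    nlinarith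

/-- **THE PER-AGE BUDGET POLYNOMIAL.**  `B ≤ A`, `0 ≤ M`, `2M ≤ A` ⟹ `(5∕8)AB + (3∕8)(A−B)(A+B+M) ≤ A²`  (`= A² − … ≥ (7∕16)A(A−B) + (3∕8)B² ≥ 0`):
with `A = a_{m+k}`, `B = a_{m+1}`, `M = Δa_{m+2}` — first entry `(5∕8)·r` plus heating `(3∕8)(1−r)(1+r+δ)` per unit of budget share is at most `1`. [folklore] -/
theorem age_budget_poly {A B M : ℝ} (hBA : B ≤ A) (hM0 : 0 ≤ M) (hM : 2 * M ≤ A) :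
    5 / 8 * A * B + 3 / 8 * (A - B) * (A + B + M) ≤ A ^ 2 := by
  nlinarith [mul_nonneg (sub_nonneg.2 hBA) hM0, mul_nonneg (sub_nonneg.2 hBA) (by linarith : 0 ≤ A - 2 * M),
    mul_nonneg (by linarith : (0 : ℝ) ≤ A) (sub_nonneg.2 hBA), sq_nonneg B]

/-! ## §2 Level geometry along the flow, and the per-age cost -/

variable {B : (ℕ → ℝ) → ℝ} {γ b gIR : ℝ} {L : ℕ → ℝ} {K : ℕ} {h : ℕ → ℝ}

/-- The levels `1∕h(n)²` are non-decreasing in the scale. [folklore] -/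
theorem flow_lev_mono (hb : 0 < b) (hlo : ∀ u, SeqBox γ u → b ≤ B u) (hh : SeqBox γ h) (hf : MemFlow B gIR h) {n n' : ℕ} (hnn' : n ≤ n') :
    1 / h n ^ 2 ≤ 1 / h n' ^ 2 := by
  have hpos : ∀ j, 0 < h j := fun j => (hh j).1
  have hanti := (strictAnti_of_memFlow hb hlo hh hf).antitone
  exact one_div_le_one_div_of_le (pow_pos (hpos n') 2) (pow_le_pow_left₀ (hpos n').le (hanti hnn') 2)

/-- **A LATE INCREMENT IS BELOW AN EARLIER LEVEL**: `Δa_{n+1} ≤ a_p` for `1 ≤ p` (`Δa_{n+1} ≤ Δa_1 ≤ a_1 ≤ a_p`). [folklore] -/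
theorem flow_incr_le_lev (hmono : ∀ u v : ℕ → ℝ, SeqBox γ u → SeqBox γ v → (∀ j, u j ≤ v j) → B u ≤ B v) (hb : 0 < b)
    (hlo : ∀ u, SeqBox γ u → b ≤ B u) (hh : SeqBox γ h) (hf : MemFlow B gIR h) (n : ℕ) {p : ℕ} (hp : 1 ≤ p) :
    1 / h (n + 1) ^ 2 - 1 / h n ^ 2 ≤ 1 / h p ^ 2 := by
  have hpos : ∀ j, 0 < h j := fun j => (hh j).1
  have h1 : 1 / h (n + 1) ^ 2 - 1 / h n ^ 2 ≤ 1 / h 1 ^ 2 - 1 / h 0 ^ 2 := by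
    rw [hf.2 n, hf.2 0]
    have := increment_anti hmono hb hlo hh hf (Nat.zero_le n)
    simp only [zero_add] at this ⊢; linarith
  have h2 : 0 < 1 / h 0 ^ 2 := by have := hpos 0; positivity
  have h3 := flow_lev_mono hb hlo hh hf hp
  linarith

/-- **TWO LATE INCREMENTS ARE BELOW AN EARLIER LEVEL**: `2·Δa_{n+1} ≤ a_p` for `2 ≤ p ≤ n+1` (`a_p ≥ Δa_{p−1} + Δa_p ≥ 2Δa_{n+1}`). [folklore] -/
theorem flow_two_incr_le_lev (hmono : ∀ u v : ℕ → ℝ, SeqBox γ u → SeqBox γ v → (∀ j, u j ≤ v j) → B u ≤ B v) (hb : 0 < b)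
    (hlo : ∀ u, SeqBox γ u → b ≤ B u) (hh : SeqBox γ h) (hf : MemFlow B gIR h) {n p : ℕ} (hp : 2 ≤ p) (hpn : p ≤ n + 1) :
    2 * (1 / h (n + 1) ^ 2 - 1 / h n ^ 2) ≤ 1 / h p ^ 2 := by
  have hpos : ∀ j, 0 < h j := fun j => (hh j).1
  obtain ⟨q, rfl⟩ : ∃ q, p = q + 2 := ⟨p - 2, by omega⟩
  have e1 : 1 / h (q + 2) ^ 2 = 1 / h q ^ 2 + B (fun j => h (q + 1 + j)) + B (fun j => h (q + 1 + 1 + j)) := by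
    rw [show q + 2 = (q + 1) + 1 by ring, hf.2 (q + 1), hf.2 q]
  have e2 : 1 / h (n + 1) ^ 2 - 1 / h n ^ 2 = B (fun j => h (n + 1 + j)) := by rw [hf.2 n]; ring
  have h1 : B (fun j => h (n + 1 + j)) ≤ B (fun j => h (q + 1 + j)) := increment_anti hmono hb hlo hh hf (by omega)
  have h2 : B (fun j => h (n + 1 + j)) ≤ B (fun j => h (q + 1 + 1 + j)) := increment_anti hmono hb hlo hh hf (by omega)
  have h3 : 0 < 1 / h q ^ 2 := by have := hpos q; positivity
  rw [e2]; linarith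

/-- **THE COST OF THE AGE `1`**: no interior window, and the first entry is within the share: `L_1h(m+1)³∕2 ≤ L_1h(m+2)·h(m+1)²` (`h(m+1) ≤ 2h(m+2)` since
`a_{m+2} ≤ 2a_{m+1}`). [folklore] -/
theorem flow_age_one_le (hmono : ∀ u v : ℕ → ℝ, SeqBox γ u → SeqBox γ v → (∀ j, u j ≤ v j) → B u ≤ B v) (hL : ∀ k, 0 ≤ L k) (hb : 0 < b)
    (hlo : ∀ u, SeqBox γ u → b ≤ B u) (hh : SeqBox γ h) (hf : MemFlow B gIR h) (m : ℕ) :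
    L 1 * h (m + 1) ^ 3 / 2 ≤ L 1 * h (m + 1 + 1) * h (m + 1) ^ 2 := by
  have hpos : ∀ j, 0 < h j := fun j => (hh j).1
  have h1 := hpos (m + 1); have h2 := hpos (m + 1 + 1)
  -- a_{m+2} ≤ 2 a_{m+1}
  have hincr := flow_incr_le_lev hmono hb hlo hh hf (m + 1) (p := m + 1) (by omega)
  have hlev : 1 / h (m + 1 + 1) ^ 2 ≤ 4 * (1 / h (m + 1) ^ 2) := by
    have : 0 < 1 / h (m + 1) ^ 2 := by positivity
    linarith
  -- hence h(m+1) ≤ 2 h(m+2)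
  have hsq : h (m + 1) ^ 2 ≤ (2 * h (m + 1 + 1)) ^ 2 := by
    rw [mul_pow]
    have e : 1 / h (m + 1 + 1) ^ 2 * (h (m + 1) ^ 2 * h (m + 1 + 1) ^ 2) = h (m + 1) ^ 2 := by field_simp
    have e' : 4 * (1 / h (m + 1) ^ 2) * (h (m + 1) ^ 2 * h (m + 1 + 1) ^ 2) = 2 ^ 2 * h (m + 1 + 1) ^ 2 := by field_simp; ring
    have := mul_le_mul_of_nonneg_right hlev (by positivity : 0 ≤ h (m + 1) ^ 2 * h (m + 1 + 1) ^ 2)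
    rw [e, e'] at this; exact this
  have hle : h (m + 1) ≤ 2 * h (m + 1 + 1) := (pow_le_pow_iff_left₀ h1.le (by positivity) two_ne_zero).1 hsq
  have := hL 1
  nlinarith [mul_nonneg this (mul_nonneg (pow_pos h1 2).le (by linarith : 0 ≤ 2 * h (m + 1 + 1) - h (m + 1)))]

/-- **THE COST OF AN AGE `k ≥ 2`** at the row `m`, per unit of `ε(m+1)`: FIRST ENTRY + DECAY × INTERIOR WINDOW ≤ SHARE ∕ LEVEL.  With `S` the interior window sum
bounded through the level gauge, `0 ≤ S ≤ ε1·h(m+1)²·Σ_{l∈[1,k)} 1∕h(m+1+l)²`, and `ε1 ≥ 0`: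
`(L_kh(m+k)³∕2)·ε1 + (L_kh(m+k)³∕2 − L_kh(m+1+k)³∕2)·S ≤ L_kh(m+1+k)·h(m+1)²·ε1`.  Ingredients: `a_{m+1+k} ≤ (25∕16)a_{m+k}` (first entry ≤ `(5∕8)·share∕a_{m+k}`),
(E116b) `flow_rate_decay_le`, `stieltjes_sum_le` with the late increment `Δa_{m+k+1}` below the interior increments and `Δa_{m+2}` above them, `age_budget_poly`.
[folklore] -/
theorem flow_age_ge_two_le (hmono : ∀ u v : ℕ → ℝ, SeqBox γ u → SeqBox γ v → (∀ j, u j ≤ v j) → B u ≤ B v) (hL : ∀ k, 0 ≤ L k) (hb : 0 < b)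
    (hlo : ∀ u, SeqBox γ u → b ≤ B u) (hh : SeqBox γ h) (hf : MemFlow B gIR h) (m : ℕ) {k : ℕ} (hk : 2 ≤ k)
    {S ε1 : ℝ} (hε1 : 0 ≤ ε1) (hS0 : 0 ≤ S) (hS : S ≤ ε1 * h (m + 1) ^ 2 * ∑ l ∈ Ico 1 k, 1 / h (m + 1 + l) ^ 2) :
    L k * h (m + k) ^ 3 / 2 * ε1 + (L k * h (m + k) ^ 3 / 2 - L k * h (m + 1 + k) ^ 3 / 2) * S
      ≤ L k * h (m + 1 + k) * h (m + 1) ^ 2 * ε1 := by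
  have hpos : ∀ j, 0 < h j := fun j => (hh j).1
  have hanti := (strictAnti_of_memFlow hb hlo hh hf).antitone
  have hLk := hL k
  have h0 := hpos (m + k); have h1 := hpos (m + 1 + k); have hm1 := hpos (m + 1)
  -- letters: A = a_{m+k}, Bl = a_{m+1}, D = Δa_{m+k+1}, M = Δa_{m+2}, β = L_k h(m+1+k)
  set A : ℝ := 1 / h (m + k) ^ 2 with hA
  set Bl : ℝ := 1 / h (m + 1) ^ 2 with hBl
  set D : ℝ := 1 / h (m + 1 + k) ^ 2 - 1 / h (m + k) ^ 2 with hD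
  set M : ℝ := 1 / h (m + 2) ^ 2 - 1 / h (m + 1) ^ 2 with hM
  set β : ℝ := L k * h (m + 1 + k) with hβ
  have hA0 : 0 < A := by positivity
  have hBl0 : 0 < Bl := by positivity
  have hβ0 : 0 ≤ β := mul_nonneg hLk h1.le
  have hBA : Bl ≤ A := flow_lev_mono hb hlo hh hf (by omega)
  have hD0 : 0 ≤ D := by have := flow_lev_mono hb hlo hh hf (show m + k ≤ m + 1 + k by omega); simp only [hD]; linarith
  have hM0 : 0 ≤ M := by have := flow_lev_mono hb hlo hh hf (show m + 1 ≤ m + 2 by omega); simp only [hM]; linarith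
  -- 2 D ≤ A (m + k ≥ 2) and 2 M ≤ A (M ≤ a_{m+2}/2 ≤ A/2)
  have h2D : 2 * D ≤ A := by
    have := flow_two_incr_le_lev hmono hb hlo hh hf (n := m + k) (p := m + k) (by omega) (by omega)
    rw [show m + k + 1 = m + 1 + k by ring] at this; exact this
  have h2M : 2 * M ≤ A := by
    have h' := flow_two_incr_le_lev hmono hb hlo hh hf (n := m + 1) (p := m + 2) (by omega) (by omega)
    rw [show m + 1 + 1 = m + 2 by ring] at h'
    have := flow_lev_mono hb hlo hh hf (show m + 2 ≤ m + k by omega)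
    simp only [hM]; linarith
  -- (p1) first entry: L h(m+k)³/2 ≤ (5/8) β / A, from 16 a_{m+1+k} ≤ 25 a_{m+k}
  have hlev : 1 / h (m + 1 + k) ^ 2 ≤ 25 / 16 * (1 / h (m + k) ^ 2) := by
    have : 1 / h (m + 1 + k) ^ 2 = A + D := by simp only [hA, hD]; ring
    rw [this]; simp only [hA] at h2D ⊢; linarith
  have hratio : h (m + k) ≤ 5 / 4 * h (m + 1 + k) := by
    have hsq : h (m + k) ^ 2 ≤ (5 / 4 * h (m + 1 + k)) ^ 2 := by
      rw [mul_pow]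
      have e : 1 / h (m + 1 + k) ^ 2 * (h (m + k) ^ 2 * h (m + 1 + k) ^ 2) = h (m + k) ^ 2 := by field_simp
      have e' : 25 / 16 * (1 / h (m + k) ^ 2) * (h (m + k) ^ 2 * h (m + 1 + k) ^ 2) = (5 / 4) ^ 2 * h (m + 1 + k) ^ 2 := by
        field_simp; ring
      have := mul_le_mul_of_nonneg_right hlev (by positivity : 0 ≤ h (m + k) ^ 2 * h (m + 1 + k) ^ 2)
      rw [e, e'] at this; exact this
    exact (pow_le_pow_iff_left₀ h0.le (by positivity) two_ne_zero).1 hsq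
  have hp1 : L k * h (m + k) ^ 3 / 2 ≤ 5 / 8 * β / A := by
    have e : 5 / 8 * β / A = 5 / 8 * (L k * h (m + 1 + k)) * h (m + k) ^ 2 := by simp only [hβ, hA]; field_simp
    rw [e]
    nlinarith [mul_nonneg hLk (mul_nonneg (pow_pos h0 2).le (by linarith : 0 ≤ 5 / 4 * h (m + 1 + k) - h (m + k)))]
  -- (p2) decay: d ≤ (3/4) β D / A²
  have hp2 : L k * h (m + k) ^ 3 / 2 - L k * h (m + 1 + k) ^ 3 / 2 ≤ 3 / 4 * β * D * h (m + k) ^ 4 :=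
    flow_rate_decay_le hL hb hlo hh hf k m
  have hA2 : h (m + k) ^ 4 = 1 / A ^ 2 := by simp only [hA]; field_simp
  -- (p3)+(p4) Stieltjes: D · Σ_{l∈[1,k)} a_{m+1+l} ≤ (A − Bl)(A + Bl + M)/2
  obtain ⟨j, rfl⟩ : ∃ j, k = j + 1 := ⟨k - 1, by omega⟩
  have hx0 : ∀ l, 0 ≤ 1 / h (m + 1 + l) ^ 2 := fun l => by have := hpos (m + 1 + l); positivity
  have hst := stieltjes_sum_le (x := fun l => 1 / h (m + 1 + l) ^ 2) (D := D) (M := M) hD0 hx0 j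
    (fun l hl1 hlj => by
      -- D = Δa_{m+j+2} ≤ Δa_{m+1+l} = x l − x (l−1)
      obtain ⟨i, rfl⟩ : ∃ i, l = i + 1 := ⟨l - 1, by omega⟩
      simp only [Nat.add_sub_cancel, hD]
      rw [show m + 1 + (i + 1) = (m + 1 + i) + 1 by ring, hf.2 (m + 1 + i),
        show m + 1 + (j + 1) = (m + (j + 1)) + 1 by ring, hf.2 (m + (j + 1))]
      have := increment_anti hmono hb hlo hh hf (show m + 1 + i ≤ m + (j + 1) by omega)
      linarith)
    (fun l hl1 hlj => by
      obtain ⟨i, rfl⟩ : ∃ i, l = i + 1 := ⟨l - 1, by omega⟩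
      simp only [Nat.add_sub_cancel, hM]
      rw [show m + 1 + (i + 1) = (m + 1 + i) + 1 by ring, hf.2 (m + 1 + i), show m + 2 = (m + 1) + 1 by ring, hf.2 (m + 1)]
      have := increment_anti hmono hb hlo hh hf (show m + 1 ≤ m + 1 + i by omega)
      linarith)
  simp only [add_zero] at hst
  rw [show m + 1 + j = m + (j + 1) by ring] at hst
  -- hst : D * Σ_{l∈Ico 1 (j+1)} 1/h(m+1+l)² ≤ (A − Bl)(A + Bl + M)/2
  have hDS : D * S ≤ ε1 * h (m + 1) ^ 2 * ((A - Bl) * (A + Bl + M) / 2) := by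
    calc D * S ≤ D * (ε1 * h (m + 1) ^ 2 * ∑ l ∈ Ico 1 (j + 1), 1 / h (m + 1 + l) ^ 2) := mul_le_mul_of_nonneg_left hS hD0
      _ = ε1 * h (m + 1) ^ 2 * (D * ∑ l ∈ Ico 1 (j + 1), 1 / h (m + 1 + l) ^ 2) := by ring
      _ ≤ ε1 * h (m + 1) ^ 2 * ((A - Bl) * (A + Bl + M) / 2) := mul_le_mul_of_nonneg_left hst (by positivity)
  have hm1sq : h (m + 1) ^ 2 = 1 / Bl := by simp only [hBl]; field_simp
  -- heating ≤ (3/4) β (1/A²) · (D S)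
  have hheat : (L (j + 1) * h (m + (j + 1)) ^ 3 / 2 - L (j + 1) * h (m + 1 + (j + 1)) ^ 3 / 2) * S
      ≤ 3 / 4 * β * (1 / A ^ 2) * (ε1 * (1 / Bl) * ((A - Bl) * (A + Bl + M) / 2)) := by
    calc (L (j + 1) * h (m + (j + 1)) ^ 3 / 2 - L (j + 1) * h (m + 1 + (j + 1)) ^ 3 / 2) * S
        ≤ 3 / 4 * β * D * h (m + (j + 1)) ^ 4 * S := mul_le_mul_of_nonneg_right hp2 hS0
      _ = 3 / 4 * β * (1 / A ^ 2) * (D * S) := by rw [hA2]; ring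
      _ ≤ 3 / 4 * β * (1 / A ^ 2) * (ε1 * h (m + 1) ^ 2 * ((A - Bl) * (A + Bl + M) / 2)) :=
          mul_le_mul_of_nonneg_left hDS (by positivity)
      _ = 3 / 4 * β * (1 / A ^ 2) * (ε1 * (1 / Bl) * ((A - Bl) * (A + Bl + M) / 2)) := by rw [hm1sq]
  have hfirst : L (j + 1) * h (m + (j + 1)) ^ 3 / 2 * ε1 ≤ 5 / 8 * β / A * ε1 := mul_le_mul_of_nonneg_right hp1 hε1
  -- the polynomial closes it
  have hpoly := age_budget_poly hBA hM0 h2M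
  have htarget : L (j + 1) * h (m + 1 + (j + 1)) * h (m + 1) ^ 2 * ε1 = β * (1 / Bl) * ε1 := by rw [hm1sq]
  rw [htarget]
  have hkey : 5 / 8 * β / A * ε1 + 3 / 4 * β * (1 / A ^ 2) * (ε1 * (1 / Bl) * ((A - Bl) * (A + Bl + M) / 2)) ≤ β * (1 / Bl) * ε1 := by
    have e : β * (1 / Bl) * ε1 - (5 / 8 * β / A * ε1 + 3 / 4 * β * (1 / A ^ 2) * (ε1 * (1 / Bl) * ((A - Bl) * (A + Bl + M) / 2)))
        = β * ε1 * (A ^ 2 - (5 / 8 * A * Bl + 3 / 8 * (A - Bl) * (A + Bl + M))) / (A ^ 2 * Bl) := by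
      field_simp; ring
    have : 0 ≤ β * ε1 * (A ^ 2 - (5 / 8 * A * Bl + 3 / 8 * (A - Bl) * (A + Bl + M))) / (A ^ 2 * Bl) := by
      apply div_nonneg _ (by positivity)
      exact mul_nonneg (mul_nonneg hβ0 hε1) (by linarith)
    linarith
  linarith

end Summit.QuantumFields.BalabanUV.Beta.EriceRemainderEnclosureHistoryAutonomyComparisonAgeCompositionLevelGaugePrep

end
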